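import Mathlib.Data.Fin.VecNotation
import Mathlib.Tactic.FinCases
import Literature.Computability.Complexity.ACRealize
import HarnessLib

/-!
# Binary connectives and literals for the `ACReal` toolkit

`ACRealize.lean` builds constant-depth unbounded fan-in circuits (`ACReal f d s`) from input
literals, constants, free negation and the `∧`/`∨` of a *family* (`acReal_forall`,
`acReal_exists`). This small companion records the ubiquitous special cases once, so that users
of the toolkit do not re-derive them: the binary `∧`/`∨` of two realizations of equal depth
(`acReal_and`, `acReal_or`: depth `+ 1`, sizes add `+ 1` — the case `M = 2` of the family
versions) and a signed literal `[y w = pol]` (`acReal_lit`: depth `0`, at most one gate).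
Everything is proved (Vollmer 1999, §1.2).

## References

* H. Vollmer, *Introduction to Circuit Complexity* (1999), §1.2.
-/

namespace Literature.Computability.Complexity

variable {ι : Type*}

/-- Binary `∧` of two realizations of equal depth: depth `+ 1`, sizes add `+ 1` (the case
`M = 2` of `acReal_forall`). [cite: Vollmer1999, §1.2] -/
theorem acReal_and {f g : (ι → Bool) → Bool} {d s t : ℕ} (hf : ACReal f d s)
    (hg : ACReal g d t) : ACReal (fun x => f x && g x) (d + 1) (s + t + 1) := by
  have h := acReal_forall (M := 2) (f := ![f, g]) (s := ![s, t])
    (fun j => by fin_cases j <;> simpa)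
  refine (h.congr fun x => ?_).mono le_rfl (by simp [Fin.sum_univ_two])
  simp [Fin.forall_fin_two]

/-- Binary `∨` of two realizations of equal depth: depth `+ 1`, sizes add `+ 1` (the case
`M = 2` of `acReal_exists`). [cite: Vollmer1999, §1.2] -/
theorem acReal_or {f g : (ι → Bool) → Bool} {d s t : ℕ} (hf : ACReal f d s)
    (hg : ACReal g d t) : ACReal (fun x => f x || g x) (d + 1) (s + t + 1) := by
  have h := acReal_exists (M := 2) (f := ![f, g]) (s := ![s, t])
    (fun j => by fin_cases j <;> simpa)
  refine (h.congr fun x => ?_).mono le_rfl (by simp [Fin.sum_univ_two])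
  simp [Fin.exists_fin_two]

/-- A signed literal `[y w = pol]` is realized at depth `0` with at most one gate (none for a
positive literal, one free negation for a negative one). [cite: Vollmer1999, §1.2] -/
theorem acReal_lit (w : ι) (pol : Bool) :
    ACReal (fun y : ι → Bool => decide (y w = pol)) 0 1 := by
  cases pol
  · exact (acReal_notInput w).congr fun y => by cases y w <;> rfl
  · exact ((acReal_input w).mono le_rfl (Nat.zero_le 1)).congr fun y => by cases y w <;> rfl

end Literature.Computability.Complexity
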